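import Literature.Analysis.FluidPDE.NSLocalAnalyticityRadius
import Mathlib.MeasureTheory.Function.LpSeminorm.CompareExp
import Mathlib.Analysis.MeanInequalities
import Mathlib.MeasureTheory.Measure.Lebesgue.EqHaar
import HarnessLib

/-!
# BGK local analyticity radius: tools for the reduction to small data at unit scale

Analysis/FluidPDE proofs file (theorems only), companion of `NSLocalAnalyticityRadius.lean`
(named fact `bradshawGrujicKukavica2015_local_analyticity_radius`, Bradshaw–Grujić–Kukavica,
J. Differential Equations 259 (2015), Thm. 2.3). After the parabolic scaling `t = 1` the window
condition of the fact, `1 < C⁻¹ min{T₀, r_*², (q²(CM)^{2q/(q-3)})⁻¹}`, forces `T₀ > C`,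
`r_*² > C` and `M < 1/C` (`bgk_small_of_window`), and on balls of unit size the `q`-dependent
local quantities dominate the `q`-free ones by Hölder's inequality
(`eLpNorm_le_eLpNorm_mul_max_one_measure`, `lintegral_sq_le_of_lintegral_rpow_le`: a pointwise
Young inequality, so that no measurability in time is needed). These are the ingredients of
`NSLocalAnalyticityRadiusUnitScale.lean`, which reduces the fact to a `q`-free, small-data,
unit-scale statement.

## References

* Z. Bradshaw, Z. Grujić, I. Kukavica, J. Differential Equations 259 (2015), Thm. 2.3.
  [BradshawGrujicKukavica2015]
-/

noncomputable section

open MeasureTheory Set Function Filter TopologicalSpace Metric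
open _root_.Topology
open scoped ENNReal

namespace Literature.Analysis.FluidPDE

/-! ### Unpacking the window at unit time -/

/-- **The window at unit time forces small local quantities.** If `C ≥ 1` and
`1 < C⁻¹ min{T₀, r², (q²(CM)^{2q/(q-3)})⁻¹}` with `M = A + B + T₀^{(r-2)/(2r)} D`, `A, B, D ≥ 0`,
`q > 3`, `r > 2q/(q-3)`, then `T₀ > C`, `r² > C` and `A, B, D < 1/C`. [folklore] -/
theorem bgk_small_of_window {C T₀ rc q r A B D : ℝ} (hC : 1 ≤ C) (hT₀ : 0 < T₀) (hq : 3 < q)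
    (hr : 2 * q / (q - 3) < r) (hA : 0 ≤ A) (hB : 0 ≤ B) (hD : 0 ≤ D)
    (hwin : 1 < C⁻¹ * min (min T₀ (rc ^ 2))
      (q ^ 2 * (C * (A + B + T₀ ^ ((r - 2) / (2 * r)) * D)) ^ (2 * q / (q - 3)))⁻¹) :
    C < T₀ ∧ C < rc ^ 2 ∧ A < 1 / C ∧ B < 1 / C ∧ D < 1 / C := by
  have hCpos : 0 < C := one_pos.trans_le hC
  have hq3 : 0 < q - 3 := sub_pos.2 hq
  have hγ0 : 0 < 2 * q / (q - 3) := div_pos (by linarith) hq3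
  have hr2 : 2 < r := by
    have h1 : (2 : ℝ) < 2 * q / (q - 3) := by rw [lt_div_iff₀ hq3]; nlinarith
    exact h1.trans hr
  set e : ℝ := (r - 2) / (2 * r) with he
  set γ : ℝ := 2 * q / (q - 3) with hγ
  set M : ℝ := A + B + T₀ ^ e * D with hM
  set m : ℝ := min (min T₀ (rc ^ 2)) (q ^ 2 * (C * M) ^ γ)⁻¹ with hm
  have hmC : C < m := by
    have h1 : C * 1 < C * (C⁻¹ * m) := mul_lt_mul_of_pos_left hwin hCpos
    rwa [mul_one, ← mul_assoc, mul_inv_cancel₀ hCpos.ne', one_mul] at h1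
  have hT : C < T₀ := hmC.trans_le ((min_le_left _ _).trans (min_le_left _ _))
  have hrc : C < rc ^ 2 := hmC.trans_le ((min_le_left _ _).trans (min_le_right _ _))
  have hX : C < (q ^ 2 * (C * M) ^ γ)⁻¹ := hmC.trans_le (min_le_right _ _)
  -- hence `C M < 1`
  have hMC : M < 1 / C := by
    have hXpos : 0 < (q ^ 2 * (C * M) ^ γ)⁻¹ := hCpos.trans hX
    have hYpos : 0 < q ^ 2 * (C * M) ^ γ := inv_pos.1 hXpos
    have hY : q ^ 2 * (C * M) ^ γ < C⁻¹ := by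
      have := inv_strictAnti₀ hCpos hX
      rwa [inv_inv] at this
    have hq2 : (1 : ℝ) ≤ q ^ 2 := by nlinarith
    have hpow : (C * M) ^ γ < 1 := by
      have h1 : (C * M) ^ γ ≤ q ^ 2 * (C * M) ^ γ :=
        le_mul_of_one_le_left (Real.rpow_nonneg (by positivity) _) hq2
      have h2 : C⁻¹ ≤ 1 := inv_le_one_of_one_le₀ hC
      linarith
    have hCM : C * M < 1 := by
      by_contra hcon
      have : 1 ≤ (C * M) ^ γ := Real.one_le_rpow (not_lt.1 hcon) hγ0.le
      linarith
    rw [lt_div_iff₀ hCpos]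
    linarith
  have hTe : 1 ≤ T₀ ^ e :=
    Real.one_le_rpow (hC.trans hT.le) (div_nonneg (by linarith) (by linarith))
  have hTD : D ≤ T₀ ^ e * D := le_mul_of_one_le_left hD hTe
  have hTD0 : 0 ≤ T₀ ^ e * D := by positivity
  refine ⟨hT, hrc, ?_, ?_, ?_⟩ <;> linarith

/-! ### Hölder on sets of finite measure, with a `q`-free constant -/

/-- `x^s ≤ max 1 x` in `ℝ≥0∞` for `0 ≤ s ≤ 1`. [folklore] -/
theorem bgk_ennreal_rpow_le_max_one_self (x : ℝ≥0∞) {s : ℝ} (hs0 : 0 ≤ s) (hs1 : s ≤ 1) :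
    x ^ s ≤ max 1 x := by
  rcases le_total x 1 with hx | hx
  · exact (ENNReal.rpow_le_one hx hs0).trans (le_max_left _ _)
  · calc x ^ s ≤ x ^ (1 : ℝ) := ENNReal.rpow_le_rpow_of_exponent_le hx hs1
      _ = x := ENNReal.rpow_one x
      _ ≤ max 1 x := le_max_right _ _

/-- **Hölder down in the exponent with a `q`-free constant**: for `1 ≤ p ≤ q` and `f` measurable,
`‖f‖_{L^p(μ)} ≤ ‖f‖_{L^q(μ)} · max(1, μ(univ))`. [folklore] -/
theorem eLpNorm_le_eLpNorm_mul_max_one_measure {α F : Type*} [MeasurableSpace α]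
    [NormedAddCommGroup F] {μ : Measure α} {f : α → F} {p q : ℝ≥0∞} (hp : 1 ≤ p) (hpq : p ≤ q)
    (hf : AEStronglyMeasurable f μ) :
    eLpNorm f p μ ≤ eLpNorm f q μ * max 1 (μ univ) := by
  refine (eLpNorm_le_eLpNorm_mul_rpow_measure_univ hpq hf).trans (mul_le_mul' le_rfl ?_)
  refine bgk_ennreal_rpow_le_max_one_self _ (sub_nonneg.2 ?_) ?_
  · -- `1/q ≤ 1/p`
    rcases eq_or_ne q ⊤ with hq | hq
    · simp [hq]
    have hp' : p ≠ ⊤ := fun h => hq (top_le_iff.1 (h ▸ hpq))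
    have hp0 : 0 < p.toReal := ENNReal.toReal_pos (by positivity) hp'
    exact one_div_le_one_div_of_le hp0 (ENNReal.toReal_mono hq hpq)
  · have h1 : 1 / p.toReal ≤ 1 := by
      rcases eq_or_ne p ⊤ with hp' | hp'
      · simp [hp']
      · rw [div_le_one (ENNReal.toReal_pos (by positivity) hp')]
        have := ENNReal.toReal_mono hp' hp
        simpa using this
    linarith [show 0 ≤ 1 / q.toReal from by positivity]

/-! ### From `L^r_t` to `L²_t` by a pointwise Young inequality -/

/-- **`∫_S G² ≤ (1 + L)/C` from `∫_S G^r ≤ D^r`, `D < 1/C`** (`r > 2`, `C ≥ 1`, `vol S ≤ L`):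
pointwise `G² = (C G²)·C⁻¹ ≤ (C G²)^{r/2} + (C⁻¹)^{r/(r-2)}` (Young), and
`C^{r/2} D^r < C^{-r/2} ≤ C⁻¹`, `C^{-r/(r-2)} ≤ C⁻¹`. No measurability of `G` is needed. [folklore] -/
theorem lintegral_sq_le_of_lintegral_rpow_le {S : Set ℝ} {G : ℝ → ℝ≥0∞} {C D r L : ℝ}
    (hC : 1 ≤ C) (hr : 2 < r) (hD0 : 0 ≤ D) (hD : D < 1 / C) (hL : 0 ≤ L)
    (hS : volume S ≤ ENNReal.ofReal L) (hG : ∫⁻ t in S, G t ^ r ≤ ENNReal.ofReal (D ^ r)) :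
    ∫⁻ t in S, G t ^ (2 : ℝ) ≤ ENNReal.ofReal ((1 + L) / C) := by
  have hCpos : 0 < C := one_pos.trans_le hC
  have hr0 : 0 < r := by linarith
  -- the conjugate exponents `r/2`, `r/(r-2)`
  have hconj : (r / 2).HolderConjugate (r / (r - 2)) :=
    ⟨by rw [inv_one, inv_div, inv_div, ← add_div, show 2 + (r - 2) = r by ring,
      div_self hr0.ne'], by positivity, div_pos hr0 (by linarith)⟩
  have hpt : ∀ t, G t ^ (2 : ℝ) ≤ (G t ^ (2 : ℝ) * ENNReal.ofReal C) ^ (r / 2) +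
      ENNReal.ofReal C⁻¹ ^ (r / (r - 2)) := by
    intro t
    have hsplit : G t ^ (2 : ℝ) = (G t ^ (2 : ℝ) * ENNReal.ofReal C) * ENNReal.ofReal C⁻¹ := by
      rw [mul_assoc, ← ENNReal.ofReal_mul hCpos.le, mul_inv_cancel₀ hCpos.ne', ENNReal.ofReal_one,
        mul_one]
    have hy := ENNReal.young_inequality (G t ^ (2 : ℝ) * ENNReal.ofReal C) (ENNReal.ofReal C⁻¹)
      hconj
    rw [← hsplit] at hy
    refine hy.trans (add_le_add ?_ ?_)
    · refine ENNReal.div_le_of_le_mul (le_mul_of_one_le_right' ?_)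
      rw [← ENNReal.ofReal_one]
      exact ENNReal.ofReal_le_ofReal (by rw [le_div_iff₀ two_pos]; linarith)
    · refine ENNReal.div_le_of_le_mul (le_mul_of_one_le_right' ?_)
      rw [← ENNReal.ofReal_one]
      exact ENNReal.ofReal_le_ofReal (by rw [le_div_iff₀ (by linarith)]; linarith)
  -- integrate
  have hpow : ∀ t, (G t ^ (2 : ℝ) * ENNReal.ofReal C) ^ (r / 2) =
      ENNReal.ofReal (C ^ (r / 2)) * G t ^ r := by
    intro t
    rw [ENNReal.mul_rpow_of_nonneg _ _ (by positivity), ← ENNReal.rpow_mul,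
      show (2 : ℝ) * (r / 2) = r by ring, ENNReal.ofReal_rpow_of_pos hCpos, mul_comm]
  calc ∫⁻ t in S, G t ^ (2 : ℝ)
      ≤ ∫⁻ t in S,
          (ENNReal.ofReal (C ^ (r / 2)) * G t ^ r + ENNReal.ofReal C⁻¹ ^ (r / (r - 2))) := by
        refine lintegral_mono fun t => ?_
        rw [← hpow t]
        exact hpt t
    _ = ENNReal.ofReal (C ^ (r / 2)) * (∫⁻ t in S, G t ^ r) +
        ENNReal.ofReal C⁻¹ ^ (r / (r - 2)) * volume S := by
        rw [lintegral_add_right' _ aemeasurable_const,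
          lintegral_const_mul' _ _ ENNReal.ofReal_ne_top,
          lintegral_const, Measure.restrict_apply_univ]
    _ ≤ ENNReal.ofReal (C ^ (r / 2)) * ENNReal.ofReal (D ^ r) +
        ENNReal.ofReal C⁻¹ ^ (r / (r - 2)) * ENNReal.ofReal L := by
        gcongr
    _ ≤ ENNReal.ofReal (1 / C) + ENNReal.ofReal (1 / C) * ENNReal.ofReal L := by
        gcongr
        · -- `C^{r/2} D^r ≤ 1/C`
          rw [← ENNReal.ofReal_mul (by positivity)]
          refine ENNReal.ofReal_le_ofReal ?_
          have hDr : D ^ r ≤ (1 / C) ^ r := Real.rpow_le_rpow hD0 hD.le hr0.le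
          have h1 : C ^ (r / 2) * (1 / C) ^ r = C ^ (-(r / 2)) := by
            rw [one_div, Real.inv_rpow hCpos.le, ← Real.rpow_neg hCpos.le, ← Real.rpow_add hCpos]
            congr 1; ring
          have h2 : C ^ (-(r / 2)) ≤ C ^ (-1 : ℝ) :=
            Real.rpow_le_rpow_of_exponent_le hC (by linarith)
          calc C ^ (r / 2) * D ^ r ≤ C ^ (r / 2) * (1 / C) ^ r :=
                mul_le_mul_of_nonneg_left hDr (by positivity)
            _ = C ^ (-(r / 2)) := h1
            _ ≤ C ^ (-1 : ℝ) := h2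
            _ = 1 / C := by rw [Real.rpow_neg_one, one_div]
        · -- `(C⁻¹)^{r/(r-2)} ≤ 1/C`
          rw [ENNReal.ofReal_rpow_of_pos (inv_pos.2 hCpos)]
          refine ENNReal.ofReal_le_ofReal ?_
          rw [one_div, Real.inv_rpow hCpos.le, ← Real.rpow_neg hCpos.le, ← Real.rpow_neg_one]
          refine Real.rpow_le_rpow_of_exponent_le hC ?_
          rw [neg_le_neg_iff, le_div_iff₀ (by linarith)]
          linarith
    _ = ENNReal.ofReal ((1 + L) / C) := by
        rw [← ENNReal.ofReal_mul (by positivity),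
          ← ENNReal.ofReal_add (by positivity) (by positivity)]
        congr 1
        ring

/-! ### Geometry of the balls `B(x₁, R)` inside `B(0, 4r)` -/

/-- For `R ≤ r` and `x₁ ∈ B(0, r)`: `B(x₁, R) ⊆ B(0, 4r)`. [folklore] -/
theorem ball_subset_ball_four_mul {x₁ : EuclideanSpace ℝ (Fin 3)} {rc R : ℝ} (hR : R ≤ rc)
    (hx₁ : x₁ ∈ ball (0 : EuclideanSpace ℝ (Fin 3)) rc) :
    ball x₁ R ⊆ ball (0 : EuclideanSpace ℝ (Fin 3)) (4 * rc) := by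
  intro x hx
  rw [mem_ball] at hx hx₁ ⊢
  have : 0 ≤ dist x₁ 0 := dist_nonneg
  linarith [dist_triangle x x₁ 0]

/-- The volume of `B(x₁, R) ⊆ ℝ³` is that of `B(0, R)`, and is finite. [folklore] -/
theorem volume_ball_eq_volume_ball_zero (x₁ : EuclideanSpace ℝ (Fin 3)) (R : ℝ) :
    volume (ball x₁ R) = volume (ball (0 : EuclideanSpace ℝ (Fin 3)) R) ∧
      volume (ball x₁ R) ≠ ⊤ := by
  refine ⟨?_, measure_ball_lt_top.ne⟩
  rw [Measure.addHaar_ball_center volume x₁, Measure.addHaar_ball_center volume 0]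

end Literature.Analysis.FluidPDE

end
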